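import Literature.AlgebraicGeometry.Motives.WeilHermitianSplitting
import Literature.AlgebraicGeometry.Motives.HyperbolicWeilType
import HarnessLib

/-!
# The aiming arithmetic of the product trick: `E ⊕ Im⟨m₁ r₁, -m₂ r₂⟩` is hyperbolic for suitable weights

Layer `Literature/AlgebraicGeometry/Motives`, companion of `Motives/WeilHermitianSplitting`
(`exists_weil_presplitting`: van Geemen 5.4 via Meyer), `Motives/WeilFormIsotropicExtension`,
`Motives/WeilDiscriminantRealization` (`diagWeilForm`) and `Motives/WeilDiscriminantProduct`
(`bilinOrthSum`). The AIMING of the partner surface in the printed proof of the product trick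
(Schoen, Compositio 114 (1998), §10 "choose `f'` with `f' f_A = f`"; Markman, arXiv:2509.23403 §11.5
Step 2; van Geemen, LNM 1594 (1994), 5.2–5.4; Landherr 1936) is pure arithmetic of Hermitian forms
over `K = ℚ(√-d)`: a Weil–Hermitian space `(V, H)` of signature `(n, n)` (the `H₁` of the Weil
`2n`-fold) becomes HYPERBOLIC — acquires a totally isotropic `K`-subspace of dimension `n + 1` —
after adding the binary space `⟨m₁ r₁⟩ ⊥ ⟨-m₂ r₂⟩` (the `H₁` of a Weil surface `E₀ × E₀` with
polarisation weights `(m₁, m₂)`) for suitable positive integers `m₁, m₂`, whatever the prescribed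
rationals `r₁, r₂` of the same sign:

* `exists_nat_mul_eq_sq_mul`, `exists_nat_mul_eq_nat_mul` — two facts about positive rationals;
* `bilinOrthSum_diag_alt_weil` — the summed form `E ⊕ E_c` on `V × K²` is alternating of Weil type;
* `exists_lagrangian_sum` — for `n ≥ 1`: from a pre-splitting `V ⊇ L ⊥ K p ⊥ K q` (`L` totally
  isotropic of dimension `n - 1`, `Q(p) = a > 0`, `Q(q) = -b < 0`) and weights `c` with
  `c_j = t² b`-type matching, `L × 0 ⊕ K (s p, e_i) ⊕ K (t q, e_j)` is totally isotropic of
  dimension `n + 1`;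
* `exists_lagrangian_zero` — `n = 0`: `m₁ r₁ = m₂ r₂` and the line `K (0, e₁ + e₂)`;
* `aimingArithmetic` — **the aiming lemma for every `d > 0`**: `K ∋ α`, `α² = -d`, `K = ℚ + ℚ α`;
  `V` a `K`-space of dimension `2n` with an alternating `ℚ`-bilinear Weil form `E`
  (`E(α x, α y) = d E(x, y)`) whose Hermitian form has signature `(n, n)` (definite `K`-subspaces
  `P`, `N` of dimension `n`, `P ⊓ N = 0`); then for all rationals `r₁ r₂ > 0` there are positive
  integers `m₁, m₂` and a `K`-subspace of `V × K²` of dimension `n + 1` on which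
  `E ⊕ Im⟨m₁ r₁, -m₂ r₂⟩` vanishes identically — proof WITHOUT a classification theorem:
  `exists_weil_presplitting` (Meyer's theorem `meyer_holds` + induction), the two Lagrangian lemmas,
  and `H`-isotropy ⟹ `E`-isotropy (`apply_eq_zero_of_weilHermitianForm_eq_zero`).

Provenance: first landed on the summit side (route `HeckePrymWeil` of the Hodge summit, files
`Theorems/HeckePrymWeilWeilTwelvefoldsSqrtMinus7AimingArithmetic` — the general-`d` lemmas — and
`Theorems/HeckePrymWeilAimedDescendingAiming` — `aimingArithmetic` —, same statements and proofs);
re-hosted here because the facts that need it are Literature facts, whose discharges cannot import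
`Summits` (CONVENTIONS §2). Everything is proved; no definition and no named fact is introduced.

## References

* [vanGeemen1994HodgeAV] B. van Geemen, An introduction to the Hodge conjecture for abelian
  varieties, LNM 1594 (1994), Lemma 5.2 (2)–(4), 5.3, 5.4 (5.4.1).
* [Deligne1982HodgeCycles] P. Deligne (notes by J. S. Milne), Hodge cycles on abelian varieties,
  LNM 900 (1982), §4, Cor. 4.2.
* [Schoen1998HodgeWeilAddendum] C. Schoen, Compositio Math. 114 (1998), §10.
* [Markman2025SurveySecant] E. Markman, arXiv:2509.23403, §11.5 Step 2.
-/

noncomputable section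

open Module
open Literature.AlgebraicGeometry

namespace Literature.AlgebraicGeometry.Motives

/-! ### Two facts about positive rationals -/

/-- For positive rationals `a`, `r` there is a positive integer `m` with `m r / a` a rational
square. [folklore] -/
theorem exists_nat_mul_eq_sq_mul {a r : ℚ} (ha : 0 < a) (hr : 0 < r) :
    ∃ m : ℕ, 0 < m ∧ ∃ s : ℚ, (m : ℚ) * r = s ^ 2 * a := by
  set ρ : ℚ := r / a with hρ
  have hρ0 : 0 < ρ := div_pos hr ha
  have hnum : 0 < ρ.num := Rat.num_pos.2 hρ0
  have hden : 0 < ρ.den := ρ.den_pos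
  have hcast : ((ρ.num.toNat : ℕ) : ℚ) = (ρ.num : ℚ) := by
    have h : ((ρ.num.toNat : ℕ) : ℤ) = ρ.num := Int.toNat_of_nonneg hnum.le
    exact_mod_cast h
  have hρ' : (ρ.num : ℚ) * a = r * ρ.den := by
    have h := Rat.num_div_den ρ
    rw [hρ, div_eq_div_iff (Nat.cast_ne_zero.2 hden.ne') ha.ne'] at h
    exact h
  refine ⟨ρ.num.toNat * ρ.den, Nat.mul_pos (by omega) hden, ρ.num, ?_⟩
  rw [Nat.cast_mul, hcast]
  linear_combination (ρ.num : ℚ) * hρ'.symm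

/-- For rationals `r₁`, `r₂` of the same sign there are positive integers with `m₁ r₁ = m₂ r₂`.
[folklore] -/
theorem exists_nat_mul_eq_nat_mul {r₁ r₂ : ℚ} (h : 0 < r₁ * r₂) :
    ∃ m₁ m₂ : ℕ, 0 < m₁ ∧ 0 < m₂ ∧ (m₁ : ℚ) * r₁ = (m₂ : ℚ) * r₂ := by
  have hr₁ : r₁ ≠ 0 := fun h0 => by rw [h0, zero_mul] at h; exact lt_irrefl 0 h
  set ρ : ℚ := r₂ / r₁ with hρ
  have hρ0 : 0 < ρ := div_pos_iff.2 ((mul_pos_iff.1 h).imp And.symm And.symm)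
  have hnum : 0 < ρ.num := Rat.num_pos.2 hρ0
  have hden : 0 < ρ.den := ρ.den_pos
  have hcast : ((ρ.num.toNat : ℕ) : ℚ) = (ρ.num : ℚ) := by
    have h : ((ρ.num.toNat : ℕ) : ℤ) = ρ.num := Int.toNat_of_nonneg hnum.le
    exact_mod_cast h
  have hρ' : (ρ.num : ℚ) * r₁ = r₂ * ρ.den := by
    have h := Rat.num_div_den ρ
    rw [hρ, div_eq_div_iff (Nat.cast_ne_zero.2 hden.ne') hr₁] at h
    exact h
  refine ⟨ρ.num.toNat, ρ.den, by omega, hden, ?_⟩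
  rw [hcast, hρ', mul_comm]

/-! ### The summed form `E ⊕ E_c` on `V × K²` -/

-- `bilinOrthSum` lives on `V₁ × V₂` with `V₁`, `V₂` in ONE universe; the stub is stated at `Type`.
variable {K : Type} [Field K] [Algebra ℚ K] {α : K} {d : ℚ}
  {V : Type} [AddCommGroup V] [Module ℚ V] [Module K V] [IsScalarTower ℚ K V]

omit [IsScalarTower ℚ K V] in
/-- The orthogonal sum of `E` and a diagonal Weil form `E_c` on `K²` is alternating and of Weil
type, and its Hermitian form is `H ⊕ Φ_c` (`weilHermitianForm_bilinOrthSum`). [folklore] -/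
theorem bilinOrthSum_diag_alt_weil (hd : 0 < d) (hα : α * α = algebraMap ℚ K (-d))
    (hK : ∀ k : K, ∃ a b : ℚ, k = algebraMap ℚ K a + algebraMap ℚ K b * α)
    (E : LinearMap.BilinForm ℚ V) (hE : ∀ x y : V, E x y = -E y x)
    (hW : ∀ x y : V, E (α • x) (α • y) = d * E x y) (c : Fin 2 → ℚ) :
    (∀ x y, bilinOrthSum E (diagWeilForm hd hα hK (Pi.basisFun K (Fin 2)) c) x y =
        -bilinOrthSum E (diagWeilForm hd hα hK (Pi.basisFun K (Fin 2)) c) y x) ∧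
    (∀ x y, bilinOrthSum E (diagWeilForm hd hα hK (Pi.basisFun K (Fin 2)) c) (α • x) (α • y) =
        d * bilinOrthSum E (diagWeilForm hd hα hK (Pi.basisFun K (Fin 2)) c) x y) := by
  refine ⟨fun x y => ?_, fun x y => ?_⟩
  · rw [bilinOrthSum_apply, bilinOrthSum_apply, hE x.1 y.1, diagWeilForm_swap hd hα hK _ c y.2 x.2]
    ring
  · rw [bilinOrthSum_apply, bilinOrthSum_apply, Prod.smul_fst, Prod.smul_snd, Prod.smul_fst,
      Prod.smul_snd, hW, diagWeilForm_smul_smul]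
    ring

/-- **Assembly of the Lagrangian subspace.** Given a totally isotropic `L ⊆ V` of dimension
`n - 1` and `p, q ⊥ L`, `p ⊥ q`, and weights `c : Fin 2 → ℚ`, indices `i ≠ j`, rationals `s, t`
with `c j = -s² Q(p)`, `c i = -t² Q(q)`: the `K`-span of `L × 0`, `(s p, e_j)`, `(t q, e_i)` in
`V × K²` has dimension `n + 1` and the Hermitian form of `E ⊕ E_c` vanishes on it (pairwise
orthogonal isotropic generators; van Geemen 1994, 5.4 (5.4.1): `⟨a⟩ ⊥ ⟨-a s²⟩` is a hyperbolic
plane). [cite: vanGeemen1994HodgeAV, 5.4 (5.4.1)] -/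
theorem exists_lagrangian_sum [Module.Finite K V] (hd : 0 < d) (hα : α * α = algebraMap ℚ K (-d))
    (hK : ∀ k : K, ∃ a b : ℚ, k = algebraMap ℚ K a + algebraMap ℚ K b * α)
    (E : LinearMap.BilinForm ℚ V) (hE : ∀ x y : V, E x y = -E y x)
    (hW : ∀ x y : V, E (α • x) (α • y) = d * E x y) {n : ℕ} (hn : 1 ≤ n)
    {L : Submodule K V} {p q : V} (hL : finrank K L = n - 1)
    (hLL : ∀ x ∈ L, ∀ y ∈ L, weilHermitianForm E α x y = 0)
    (hLp : ∀ x ∈ L, weilHermitianForm E α p x = 0) (hLq : ∀ x ∈ L, weilHermitianForm E α q x = 0)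
    (hpq : weilHermitianForm E α p q = 0) (c : Fin 2 → ℚ) {i j : Fin 2} (hij : i ≠ j) (s t : ℚ)
    (hj : c j = -(s ^ 2 * E p (α • p))) (hi : c i = -(t ^ 2 * E q (α • q))) :
    ∃ L₂ : Submodule K (V × (Fin 2 → K)), finrank K L₂ = n + 1 ∧
      ∀ x ∈ L₂, ∀ y ∈ L₂,
        weilHermitianForm (bilinOrthSum E (diagWeilForm hd hα hK (Pi.basisFun K (Fin 2)) c))
          α x y = 0 := by
  set b := Pi.basisFun K (Fin 2) with hb
  set E₂ := diagWeilForm hd hα hK b c with hE₂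
  set E' := bilinOrthSum E E₂ with hE'
  obtain ⟨hE'alt, hW'⟩ := bilinOrthSum_diag_alt_weil hd hα hK E hE hW c
  have hH' : ∀ (v₁ v₂ : V) (w₁ w₂ : Fin 2 → K), weilHermitianForm E' α (v₁, w₁) (v₂, w₂) =
      weilHermitianForm E α v₁ v₂ + weilHermitianForm E₂ α w₁ w₂ := fun v₁ v₂ w₁ w₂ => by
    rw [hE', weilHermitianForm_bilinOrthSum, formOrthSum_apply]
  have hbb : ∀ k l : Fin 2, weilHermitianForm E₂ α (b k) (b l) =
      if k = l then algebraMap ℚ K (c k) else 0 := weilHermitianForm_diagWeilForm_basis hd hα hK b c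
  have hpp : weilHermitianForm E α p p = algebraMap ℚ K (E p (α • p)) := weilHermitianForm_self E hE α p
  have hqq : weilHermitianForm E α q q = algebraMap ℚ K (E q (α • q)) := weilHermitianForm_self E hE α q
  have hqp : weilHermitianForm E α q p = 0 := weilHermitianForm_comm_eq_zero E hd hα hE hW hpq
  have hpL : ∀ l : L, weilHermitianForm E α (l : V) p = 0 := fun l =>
    weilHermitianForm_comm_eq_zero E hd hα hE hW (hLp _ l.2)
  have hqL : ∀ l : L, weilHermitianForm E α (l : V) q = 0 := fun l =>
    weilHermitianForm_comm_eq_zero E hd hα hE hW (hLq _ l.2)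
  -- the generators
  set u : V × (Fin 2 → K) := (s • p, b j) with hu
  set w : V × (Fin 2 → K) := (t • q, b i) with hw
  set G : Set (V × (Fin 2 → K)) :=
    insert u (insert w (Set.range fun l : L => ((l : V), (0 : Fin 2 → K)))) with hG
  have hGiso : ∀ x ∈ G, ∀ y ∈ G, weilHermitianForm E' α x y = 0 := by
    intro x hx y hy
    simp only [hG, Set.mem_insert_iff, Set.mem_range] at hx hy
    rcases hx with rfl | rfl | ⟨l, rfl⟩ <;> rcases hy with rfl | rfl | ⟨l', rfl⟩
    · rw [hu, hH', weilHermitianForm_ratSmul_left, weilHermitianForm_ratSmul_right, hpp, hbb,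
        if_pos rfl, hj, ← map_mul, ← map_mul, ← map_add,
        show s * (s * E p (α • p)) + -(s ^ 2 * E p (α • p)) = 0 by ring, map_zero]
    · rw [hu, hw, hH', weilHermitianForm_ratSmul_left, weilHermitianForm_ratSmul_right, hpq, hbb,
        if_neg hij.symm]
      simp
    · rw [hu, hH', weilHermitianForm_ratSmul_left, hLp _ l'.2, weilHermitianForm_zero_right]
      simp
    · rw [hu, hw, hH', weilHermitianForm_ratSmul_left, weilHermitianForm_ratSmul_right, hqp, hbb,
        if_neg hij]
      simp
    · rw [hw, hH', weilHermitianForm_ratSmul_left, weilHermitianForm_ratSmul_right, hqq, hbb,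
        if_pos rfl, hi, ← map_mul, ← map_mul, ← map_add,
        show t * (t * E q (α • q)) + -(t ^ 2 * E q (α • q)) = 0 by ring, map_zero]
    · rw [hw, hH', weilHermitianForm_ratSmul_left, hLq _ l'.2, weilHermitianForm_zero_right]
      simp
    · rw [hu, hH', weilHermitianForm_ratSmul_right, hpL l, weilHermitianForm_zero_left]
      simp
    · rw [hw, hH', weilHermitianForm_ratSmul_right, hqL l, weilHermitianForm_zero_left]
      simp
    · rw [hH', hLL _ l.2 _ l'.2, weilHermitianForm_zero_left, add_zero]
  have hspan := weilHermitianForm_span_eq_zero E' hd hα hK hW' hGiso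
  -- the parametrisation `(l, a, b) ↦ (l, 0) + a u + b w`
  obtain ⟨Ψ, hΨ⟩ : ∃ Ψ : (L × (K × K)) →ₗ[K] (V × (Fin 2 → K)),
      ∀ z, Ψ z = (((z.1 : V), (0 : Fin 2 → K)) : V × (Fin 2 → K)) + (z.2.1 • u + z.2.2 • w) :=
    ⟨((LinearMap.inl K V (Fin 2 → K)) ∘ₗ L.subtype).coprod
        ((LinearMap.toSpanSingleton K _ u).coprod (LinearMap.toSpanSingleton K _ w)),
      fun z => by
        rw [LinearMap.coprod_apply, LinearMap.coprod_apply, LinearMap.toSpanSingleton_apply,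
          LinearMap.toSpanSingleton_apply]
        rfl⟩
  have hΨinj : Function.Injective Ψ := by
    rw [← LinearMap.ker_eq_bot, Submodule.eq_bot_iff]
    rintro ⟨l, a, a'⟩ hz
    rw [LinearMap.mem_ker, hΨ] at hz
    have h2 := congrArg Prod.snd hz
    simp only [Prod.snd_add, Prod.smul_snd, hu, hw, Prod.snd_zero, zero_add] at h2
    have hja : a = 0 := by
      have h := congrFun h2 j
      simpa [hb, Pi.single_apply, hij] using h
    have hia : a' = 0 := by
      have h := congrFun h2 i
      simpa [hb, Pi.single_apply, hij.symm] using h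
    have h1 := congrArg Prod.fst hz
    simp only [hja, hia, zero_smul, add_zero, Prod.fst_zero] at h1
    have hl : l = 0 := by exact_mod_cast h1
    rw [hl, hja, hia]
    rfl
  have hle : LinearMap.range Ψ ≤ Submodule.span K G := by
    rintro x ⟨z, rfl⟩
    rw [hΨ]
    refine Submodule.add_mem _ (Submodule.subset_span ?_)
      (Submodule.add_mem _ (Submodule.smul_mem _ _ (Submodule.subset_span ?_))
        (Submodule.smul_mem _ _ (Submodule.subset_span ?_)))
    · exact Set.mem_insert_of_mem _ (Set.mem_insert_of_mem _ ⟨z.1, rfl⟩)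
    · exact Set.mem_insert _ _
    · exact Set.mem_insert_of_mem _ (Set.mem_insert _ _)
  refine ⟨LinearMap.range Ψ, ?_, fun x hx y hy => hspan x (hle hx) y (hle hy)⟩
  rw [LinearMap.finrank_range_of_inj hΨinj, Module.finrank_prod, Module.finrank_prod, finrank_self,
    hL]
  omega

omit [IsScalarTower ℚ K V] in
/-- The case `n = 0`: for weights with `c 0 + c 1 = 0` the line `K · (0, e₀ + e₁)` is isotropic.
[folklore] -/
theorem exists_lagrangian_zero (hd : 0 < d) (hα : α * α = algebraMap ℚ K (-d))
    (hK : ∀ k : K, ∃ a b : ℚ, k = algebraMap ℚ K a + algebraMap ℚ K b * α)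
    (E : LinearMap.BilinForm ℚ V) (hE : ∀ x y : V, E x y = -E y x)
    (hW : ∀ x y : V, E (α • x) (α • y) = d * E x y) (c : Fin 2 → ℚ) (hc : c 0 + c 1 = 0) :
    ∃ L₂ : Submodule K (V × (Fin 2 → K)), finrank K L₂ = 1 ∧
      ∀ x ∈ L₂, ∀ y ∈ L₂,
        weilHermitianForm (bilinOrthSum E (diagWeilForm hd hα hK (Pi.basisFun K (Fin 2)) c))
          α x y = 0 := by
  set b := Pi.basisFun K (Fin 2) with hb
  obtain ⟨-, hW'⟩ := bilinOrthSum_diag_alt_weil hd hα hK E hE hW c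
  have hbb : ∀ k l : Fin 2, weilHermitianForm (diagWeilForm hd hα hK b c) α (b k) (b l) =
      if k = l then algebraMap ℚ K (c k) else 0 := weilHermitianForm_diagWeilForm_basis hd hα hK b c
  set g : V × (Fin 2 → K) := (0, b 0 + b 1) with hg
  have hg0 : g ≠ 0 := fun h => by
    have h1 := congrFun (congrArg Prod.snd h) 0
    simp [hg, hb] at h1
  have hgg : weilHermitianForm (bilinOrthSum E (diagWeilForm hd hα hK b c)) α g g = 0 := by
    rw [hg, weilHermitianForm_bilinOrthSum, formOrthSum_apply, weilHermitianForm_zero_left,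
      zero_add, weilHermitianForm_add_left, weilHermitianForm_add_right,
      weilHermitianForm_add_right, hbb, hbb, hbb, hbb, if_pos rfl, if_pos rfl,
      if_neg zero_ne_one, if_neg one_ne_zero, add_zero, zero_add, ← map_add, hc, map_zero]
  have hiso := weilHermitianForm_span_eq_zero (S := {g}) _ hd hα hK hW' fun x hx y hy => by
    rw [Set.mem_singleton_iff] at hx hy
    rw [hx, hy, hgg]
  exact ⟨Submodule.span K {g}, finrank_span_singleton hg0, hiso⟩

/-! ### The aiming arithmetic for every `d > 0` -/

/-- **The aiming arithmetic for every `d > 0` (Landherr's lever `δ² = 1`).** Let `K ∋ α`,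
`α² = -d` (`d > 0`), `K = ℚ + ℚ α`; `V` a `K`-space of dimension `2n`; `E` an alternating
`ℚ`-bilinear form on `V` of Weil type (`E(α x, α y) = d E(x, y)`) whose Hermitian form
`H(x, y) = E(x, α y) + α E(x, y)` (van Geemen 5.2 (2)) has SIGNATURE `(n, n)` (`V ⊇ P, N` definite
of dimension `n`, `P ⊓ N = 0`). Then for all rationals `r₁, r₂` of the same sign there are positive
integers `m₁, m₂` such that the orthogonal sum of `E` and the binary Weil form
`⟨m₁ r₁⟩ ⊥ ⟨-m₂ r₂⟩` on `K²` (`Motives.diagWeilForm`, `Motives.bilinOrthSum`: the `H₁` of the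
product with the CM Weil surface `E₀ × E₀` of polarisation weights `(m₁, m₂)`) is HYPERBOLIC:
`V × K²` contains a `K`-subspace of dimension `n + 1` on which the summed form vanishes
identically. Proof: for `n ≥ 1` pre-split
`V ⊇ Hyp^{n-1} ⊥ ⟨a⟩ ⊥ ⟨-b⟩` (`Motives.exists_weil_presplitting`) and take `m₂ r₂ ≡ a`,
`m₁ r₁ ≡ b` modulo squares (`exists_nat_mul_eq_sq_mul`, `exists_lagrangian_sum`); for `n = 0`,
`m₁ r₁ = m₂ r₂` (`exists_nat_mul_eq_nat_mul`, `exists_lagrangian_zero`); `H`-isotropy is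
`E`-isotropy (`Motives.apply_eq_zero_of_weilHermitianForm_eq_zero`). Schoen 1998 §10; Markman
arXiv:2509.23403 §11.5 Step 2; van Geemen 1994, 5.2–5.4; Deligne–Milne 1982 Cor. 4.2.
[cite: vanGeemen1994HodgeAV, Lemma 5.2 (2)–(4) and 5.4 (5.4.1)] [cite: Deligne1982HodgeCycles, §4 Cor. 4.2] -/
theorem aimingArithmetic {K : Type} [Field K] [Algebra ℚ K] {α : K} {d : ℚ} (hd : 0 < d)
    (hα : α * α = algebraMap ℚ K (-d))
    (hK : ∀ k : K, ∃ a b : ℚ, k = algebraMap ℚ K a + algebraMap ℚ K b * α)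
    (V : Type) [AddCommGroup V] [Module ℚ V] [Module K V] [IsScalarTower ℚ K V]
    [Module.Finite K V] (n : ℕ) (hV : finrank K V = 2 * n)
    (E : LinearMap.BilinForm ℚ V) (hE : ∀ x y : V, E x y = -E y x)
    (hW : ∀ x y : V, E (α • x) (α • y) = d * E x y)
    (hPN : ∃ P N : Submodule K V, finrank K P = n ∧ finrank K N = n ∧ P ⊓ N = ⊥ ∧
      (∀ x ∈ P, x ≠ 0 → 0 < E x (α • x)) ∧ (∀ x ∈ N, x ≠ 0 → E x (α • x) < 0))
    (r₁ r₂ : ℚ) (hr : 0 < r₁ * r₂) :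
    ∃ m₁ m₂ : ℕ, 0 < m₁ ∧ 0 < m₂ ∧
      ∃ L : Submodule K (V × (Fin 2 → K)), finrank K L = n + 1 ∧
        ∀ x ∈ L, ∀ y ∈ L,
          bilinOrthSum E (diagWeilForm hd hα hK (Pi.basisFun K (Fin 2))
            ![(m₁ : ℚ) * r₁, -((m₂ : ℚ) * r₂)]) x y = 0 := by
  -- `H`-isotropy gives `E`-isotropy
  have key : ∀ (c : Fin 2 → ℚ) (L : Submodule K (V × (Fin 2 → K))),
      (∀ x ∈ L, ∀ y ∈ L, weilHermitianForm
        (bilinOrthSum E (diagWeilForm hd hα hK (Pi.basisFun K (Fin 2)) c)) α x y = 0) →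
      ∀ x ∈ L, ∀ y ∈ L,
        bilinOrthSum E (diagWeilForm hd hα hK (Pi.basisFun K (Fin 2)) c) x y = 0 :=
    fun c L h x hx y hy => apply_eq_zero_of_weilHermitianForm_eq_zero _ hd hα (h x hx y hy)
  rcases Nat.eq_zero_or_pos n with rfl | hn
  · obtain ⟨m₁, m₂, hm₁, hm₂, hm⟩ := exists_nat_mul_eq_nat_mul hr
    obtain ⟨L, hL, hiso⟩ := exists_lagrangian_zero hd hα hK E hE hW
      ![(m₁ : ℚ) * r₁, -((m₂ : ℚ) * r₂)] (by simp [hm])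
    exact ⟨m₁, m₂, hm₁, hm₂, L, hL, key _ L hiso⟩
  · obtain ⟨L, p, q, hL, hLL, hLp, hLq, hpq, hp, hq⟩ :=
      exists_weil_presplitting hd hα hK n hn V hV E hE hW hPN
    rcases mul_pos_iff.1 hr with ⟨hr₁, hr₂⟩ | ⟨hr₁, hr₂⟩
    · -- `r₁, r₂ > 0`: `e₀` positive, `e₁` negative
      obtain ⟨m₁, hm₁, t, ht⟩ := exists_nat_mul_eq_sq_mul (neg_pos.2 hq) hr₁
      obtain ⟨m₂, hm₂, s, hs⟩ := exists_nat_mul_eq_sq_mul hp hr₂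
      obtain ⟨L₂, hL₂, hiso⟩ := exists_lagrangian_sum hd hα hK E hE hW hn hL hLL hLp hLq hpq
        ![(m₁ : ℚ) * r₁, -((m₂ : ℚ) * r₂)] (i := 0) (j := 1) zero_ne_one s t
        (by simp only [Matrix.cons_val_one, Matrix.cons_val_zero]; linarith)
        (by simp only [Matrix.cons_val_zero]; linarith)
      exact ⟨m₁, m₂, hm₁, hm₂, L₂, hL₂, key _ L₂ hiso⟩
    · -- `r₁, r₂ < 0`: `e₀` negative, `e₁` positive
      obtain ⟨m₁, hm₁, s, hs⟩ := exists_nat_mul_eq_sq_mul hp (neg_pos.2 hr₁)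
      obtain ⟨m₂, hm₂, t, ht⟩ := exists_nat_mul_eq_sq_mul (neg_pos.2 hq) (neg_pos.2 hr₂)
      obtain ⟨L₂, hL₂, hiso⟩ := exists_lagrangian_sum hd hα hK E hE hW hn hL hLL hLp hLq hpq
        ![(m₁ : ℚ) * r₁, -((m₂ : ℚ) * r₂)] (i := 1) (j := 0) one_ne_zero s t
        (by simp only [Matrix.cons_val_zero]; linarith)
        (by simp only [Matrix.cons_val_one, Matrix.cons_val_zero]; linarith)
      exact ⟨m₁, m₂, hm₁, hm₂, L₂, hL₂, key _ L₂ hiso⟩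

end Literature.AlgebraicGeometry.Motives

end
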